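import Mathlib
import Summits.Ventures.PercRepro2.SwOutAll
import Summits.Ventures.PercRepro2.SwOutArmFlip
import Summits.Ventures.PercRepro2.SwOutArms
import Summits.Ventures.PercRepro2.SwOutArmOrbit
import Summits.Ventures.PercRepro2.SwOutArmCube
import Summits.Ventures.PercRepro2.SwOutArmThm
import Summits.Ventures.PercRepro2.SwOutJunctionSplit
import Summits.Ventures.PercRepro2.SwOutJunctionFine
import Summits.Ventures.PercRepro2.SwOutJunctionRegion

/-!
# THE JUNCTION THEOREM (blind cell PercRepro2, night-4 g11, 2026-08-25; proofs/NIGHT4-G11.md §3)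

A region `U ∋ h` (`l ∉ U`, no loop at `h`) with ONE junction `u ∈ U ∖ {h, o}`: `u` has no loop, no
outside edge, every neighbour `p ≠ h` of `u` is adjacent to `h`, and every other vertex of
`U ∖ {h, o}` carries an outside edge or no edge at all.  Then every class `(U, ξ)` satisfies the
rigid counting inequality of (HLC) — although `u` may be a CORE (a vertex of both clusters of `h`),
the first such vertices beyond the arm principle of g10.

Proof: the class splits into the SPLIT-FINE configurations (every edge at `u` matched) and the
rest.  The rest is core-free and closed under the arm flips of the graph, so the arm principle of
g10 (`card_orbit_le`, orbit by orbit) handles it.  The split-fine configurations are exactly the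
core-free class configurations of the SPLIT graph at `u` (`SwOutJunctionSplit`), with the same
edge sets and the same side `Q`; the arm principle of the split graph — its orbits are the FINE
CUBES around the junction — handles them.  Both parts are sums over the fibres of an all-red map.
-/

namespace Summit.Ventures.PercRepro2

namespace LocRows

open Hull

variable {V : Type*} {E : Type*} [Fintype E] [DecidableEq E]

open scoped Classical

variable {ends : E → Sym2 V} {U : Set V} {ξ : Config E} {l h o u : V}

/-! ## Cores at the junction only -/

section Core

/-- When every vertex of `U ∖ {h, o, u}` has an outside edge or no edge, every core of a
`Q`-configuration is `h` or `u`. -/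
theorem core_eq_h_or_u
    (hout : ∀ x ∈ U, x ≠ h → x ≠ o → x ≠ u →
      (∃ e y, ends e = s(x, y) ∧ y ∉ U) ∨ (∀ e, x ∉ ends e))
    {ζ : Config E} (hζ : ζ ∈ swOutSide ends l h o U ξ) {x : V} (hxT : x ∈ cluster ends ζ h)
    (hxTp : x ∈ cluster ends (blue ζ) h) : x = h ∨ x = u := by
  by_cases hxh : x = h
  · exact Or.inl hxh
  by_cases hxu : x = u
  · exact Or.inr hxu
  exfalso
  have hQ := (mem_swOutSide.1 hζ).1
  have hcl := (mem_swOutSide.1 hζ).2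
  rw [mem_tgtU_iff'] at hQ
  obtain ⟨hhl, hoA, _⟩ := hQ
  have hhA : h ∉ cluster ends ζ l := fun h' => hhl (Or.inl h')
  have hxU : x ∈ U := (mem_outClass.1 hcl).2 (Or.inl hxT)
  by_cases hxo : x = o
  · subst hxo
    exact hhA (conn_trans hoA (conn_symm hxT))
  · rcases hout x hxU hxh hxo hxu with ⟨e, y, hxy, hyU⟩ | hiso
    · cases he : ζ e with
      | true => exact hyU ((mem_outClass.1 hcl).2 (Or.inl (mem_cluster_of_edge hxT he hxy)))
      | false =>
        have he' : blue ζ e = true := by rw [blue_eq_true_iff]; exact he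
        exact hyU ((mem_outClass.1 hcl).2 (Or.inr (mem_cluster_of_edge hxTp he' hxy)))
    · obtain ⟨e, hxe⟩ := exists_edge_of_mem_cluster hxT hxh
      exact hiso e hxe

/-- A split-fine `Q`-configuration is core-free in the split graph. -/
theorem coreFree_split_of_splitFine (hloop : ∀ e, ends e ≠ s(u, u)) (hhu : h ≠ u)
    (hout : ∀ x ∈ U, x ≠ h → x ≠ o → x ≠ u →
      (∃ e y, ends e = s(x, y) ∧ y ∉ U) ∨ (∀ e, x ∉ ends e))
    {ζ : Config E} (hζ : ζ ∈ swOutSide ends l h o U ξ) (hf : SplitFine ends u h ζ) :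
    CoreFree (splitEnds ends u) ζ (Sum.inl h) := by
  rintro (x | e) hxT hxTp
  · have h1 : x ∈ cluster ends ζ h := conn_of_conn_split_inl hxT
    have h2 : x ∈ cluster ends (blue ζ) h := conn_of_conn_split_inl hxTp
    rcases core_eq_h_or_u hout hζ h1 h2 with rfl | rfl
    · rfl
    · exact absurd hxT (inl_u_notMem_cluster_split hloop hhu)
  · exfalso
    obtain ⟨_, h1, _⟩ := conn_of_conn_split_inr hxT
    obtain ⟨_, h2, _⟩ := conn_of_conn_split_inr hxTp
    rw [blue_eq_true_iff] at h2
    rw [h1] at h2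
    exact absurd h2 (by simp)

/-- A `Q`-configuration that is not split-fine is core-free (every neighbour `p ≠ h` of `u`
adjacent to `h`). -/
theorem coreFree_of_not_splitFine (hloop : ∀ e, ends e ≠ s(u, u)) (hhu : h ≠ u)
    (hadj : ∀ e (he : u ∈ ends e), Sym2.Mem.other he ≠ h →
      ∃ e', ends e' = s(Sym2.Mem.other he, h))
    (hout : ∀ x ∈ U, x ≠ h → x ≠ o → x ≠ u →
      (∃ e y, ends e = s(x, y) ∧ y ∉ U) ∨ (∀ e, x ∉ ends e))
    {ζ : Config E} (hζ : ζ ∈ swOutSide ends l h o U ξ) (hnf : ¬ SplitFine ends u h ζ) :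
    CoreFree ends ζ h := by
  intro x hxT hxTp
  rcases core_eq_h_or_u hout hζ hxT hxTp with rfl | rfl
  · rfl
  · exfalso
    exact hnf (splitFine_of_matched hloop hhu hadj (fun y hy hy' => core_eq_h_or_u hout hζ hy hy')
      (matched_of_core hxT hxTp))

end Core

/-! ## The non-split-fine configurations are closed under the arm flips -/

section Closure

omit [Fintype E] [DecidableEq E] in
/-- Matchedness comes back along an arm flip of a core-free configuration. -/
theorem matched_of_matched_flip {ζ : Config E} {P : Set V} (hc : CoreFree ends ζ h)
    (hP : ArmClosed ends ζ h P) (hm : Matched ends u h (flip ends P ζ)) : Matched ends u h ζ := by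
  intro e he hph
  have hends : ends e = s(u, Sym2.Mem.other he) := ends_eq_other he
  have hT := cluster_flip_of_armClosed hc hP
  have hTp := cluster_blue_flip_of_armClosed hc hP
  have hm' := hm e he hph
  rw [hT, hTp] at hm'
  -- `u ∈ P` with the other end outside `P` forces the other end out of the hull
  have hclosed : u ∈ P → Sym2.Mem.other he ∉ P → Sym2.Mem.other he ∉ hull ends ζ h :=
    fun huP hpP hpH => hpP (hP.closed e u _ hends huP hpH hph)
  by_cases hte : e ∈ touches ends P
  · have hte' : u ∈ P ∨ Sym2.Mem.other he ∈ P := (mem_touches_iff_of_ends hends).1 hte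
    refine ⟨fun hred => ?_, fun hblue => ?_⟩
    · have h1 : flip ends P ζ e = false := by rw [flip_apply_of_mem hte, hred]; rfl
      rcases hm'.2 h1 with ⟨hpTp, hpP⟩ | ⟨_, hpT⟩
      · have huP : u ∈ P := by
          rcases hte' with h' | h'
          · exact h'
          · exact absurd h' hpP
        rcases (hP.subset u huP).1 with huT | huTp
        · exact mem_cluster_of_edge huT hred hends
        · exact absurd (Or.inr hpTp) (hclosed huP hpP)
      · exact hpT
    · have h1 : flip ends P ζ e = true := by rw [flip_apply_of_mem hte, hblue]; rfl
      rcases hm'.1 h1 with ⟨hpT, hpP⟩ | ⟨_, hpTp⟩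
      · have huP : u ∈ P := by
          rcases hte' with h' | h'
          · exact h'
          · exact absurd h' hpP
        rcases (hP.subset u huP).1 with huT | huTp
        · exact absurd (Or.inl hpT) (hclosed huP hpP)
        · have hb : blue ζ e = true := by rw [blue_eq_true_iff]; exact hblue
          exact mem_cluster_of_edge huTp hb hends
      · exact hpTp
  · have hpP : Sym2.Mem.other he ∉ P := fun h' => hte ⟨_, h', u, ends_swap hends⟩
    refine ⟨fun hred => ?_, fun hblue => ?_⟩
    · have h1 : flip ends P ζ e = true := by rw [flip_apply_of_notMem hte]; exact hred
      rcases hm'.1 h1 with ⟨hpT, _⟩ | ⟨hpP', _⟩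
      · exact hpT
      · exact absurd hpP' hpP
    · have h1 : flip ends P ζ e = false := by rw [flip_apply_of_notMem hte]; exact hblue
      rcases hm'.2 h1 with ⟨hpTp, _⟩ | ⟨hpP', _⟩
      · exact hpTp
      · exact absurd hpP' hpP

omit [Fintype E] [DecidableEq E] in
/-- **The non-split-fine configurations are closed under arm flips** (core-free configuration,
every neighbour `p ≠ h` of `u` adjacent to `h`). -/
theorem not_splitFine_flip (hloop : ∀ e, ends e ≠ s(u, u)) (hhu : h ≠ u)
    (hadj : ∀ e (he : u ∈ ends e), Sym2.Mem.other he ≠ h →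
      ∃ e', ends e' = s(Sym2.Mem.other he, h))
    {ζ : Config E} {P : Set V} (hc : CoreFree ends ζ h) (hP : ArmClosed ends ζ h P)
    (hnf : ¬ SplitFine ends u h ζ) : ¬ SplitFine ends u h (flip ends P ζ) := by
  intro hf
  apply hnf
  refine splitFine_of_matched hloop hhu hadj (fun x hx hx' => Or.inl (hc x hx hx')) ?_
  exact matched_of_matched_flip hc hP (matched_of_splitFine hf)

end Closure

/-! ## The junction theorem -/

section Main

variable (hl : l ∉ U) (hloop_h : ∀ e, ends e ≠ s(h, h)) (hloop_u : ∀ e, ends e ≠ s(u, u))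
  (hu : u ∈ U) (hhu : h ≠ u)
  (hadj : ∀ e (he : u ∈ ends e), Sym2.Mem.other he ≠ h →
    ∃ e', ends e' = s(Sym2.Mem.other he, h))
  (hout : ∀ x ∈ U, x ≠ h → x ≠ o → x ≠ u →
    (∃ e y, ends e = s(x, y) ∧ y ∉ U) ∨ (∀ e, x ∉ ends e))

omit [Fintype E] [DecidableEq E] in
/-- The split graph has no loop at `inl h`. -/
lemma splitEnds_ne_loop_h (hloop_h : ∀ e, ends e ≠ s(h, h)) (e : E) :
    splitEnds ends u e ≠ s(Sum.inl h, Sum.inl h) := by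
  by_cases he : u ∈ ends e
  · rw [splitEnds_of_mem he]
    intro h1
    rw [Sym2.eq_iff] at h1
    rcases h1 with ⟨_, h1⟩ | ⟨_, h1⟩
    · exact Sum.inr_ne_inl h1
    · exact Sum.inr_ne_inl h1
  · obtain ⟨p, q, hpq⟩ := exists_pair (ends e)
    rw [splitEnds_of_notMem he, hpq, Sym2.map_mk]
    intro h1
    rw [Sym2.eq_iff] at h1
    rcases h1 with ⟨h1, h2⟩ | ⟨h1, h2⟩
    · exact hloop_h e (by rw [hpq, Sum.inl.inj h1, Sum.inl.inj h2])
    · exact hloop_h e (by rw [hpq, Sum.inl.inj h1, Sum.inl.inj h2])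

omit [Fintype E] [DecidableEq E] in
/-- `inl l` is outside the split region. -/
lemma inl_notMem_splitRegion (hl : l ∉ U) : Sum.inl l ∉ splitRegion (V := V) (E := E) U := by
  rintro (⟨x, hx, hxl⟩ | ⟨e, he⟩)
  · exact hl ((Sum.inl.inj hxl) ▸ hx)
  · exact Sum.inr_ne_inl he

include hl hloop_h hloop_u hu hhu hout in
/-- **The split-fine part**: orbit by orbit of the split graph's arm principle. -/
theorem card_splitFine_le {𝓔 : Set (Set E)} (h𝓔 : IsUpperSet 𝓔) :
    ((swOutSide ends l h o U ξ).filter fun ζ =>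
        redEdges ends ζ h ∈ 𝓔 ∧ SplitFine ends u h ζ).card ≤
      ((swOutSide ends l h o U ξ).filter fun ζ =>
        blueEdges ends ζ h ∈ 𝓔 ∧ SplitFine ends u h ζ).card := by
  have hlu : l ≠ u := fun h' => hl (h' ▸ hu)
  have hl' := inl_notMem_splitRegion (V := V) (E := E) hl
  have hloop' := splitEnds_ne_loop_h (ends := ends) (u := u) hloop_h
  let can : Config E → Config E := fun ζ => allRed (splitEnds ends u) ζ (Sum.inl h)
  let F : Finset (Config E) := (swOutSide ends l h o U ξ).filter fun ζ => SplitFine ends u h ζ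
  let S₀ : Finset (Config E) := F.image can
  have hmap : ∀ (P : Config E → Prop) (ζ : Config E),
      ζ ∈ (swOutSide ends l h o U ξ).filter (fun ζ => P ζ ∧ SplitFine ends u h ζ) → can ζ ∈ S₀ := by
    intro P ζ hζ
    have hζ' := Finset.mem_filter.1 hζ
    exact Finset.mem_image_of_mem can (Finset.mem_filter.2 ⟨hζ'.1, hζ'.2.2⟩)
  rw [Finset.card_eq_sum_card_fiberwise (hmap _), Finset.card_eq_sum_card_fiberwise (hmap _)]
  refine Finset.sum_le_sum fun ζ₀ hζ₀ => ?_
  obtain ⟨ζ₁, hζ₁, rfl⟩ := Finset.mem_image.1 hζ₀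
  have hζ₁' := Finset.mem_filter.1 hζ₁
  have hSF₁ : SplitFine ends u h ζ₁ := hζ₁'.2
  have hc₁ : CoreFree (splitEnds ends u) ζ₁ (Sum.inl h) :=
    coreFree_split_of_splitFine hloop_u hhu hout hζ₁'.1 hSF₁
  have hcl₁ : ζ₁ ∈ outClass (splitEnds ends u) (splitRegion U) (Sum.inl h) ξ :=
    mem_outClass_split_of_mem hu (mem_swOutSide.1 hζ₁'.1).2
  have hc₀ : CoreFree (splitEnds ends u) (allRed (splitEnds ends u) ζ₁ (Sum.inl h)) (Sum.inl h) :=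
    coreFree_allRed hc₁
  have hcl₀ : allRed (splitEnds ends u) ζ₁ (Sum.inl h) ∈
      outClass (splitEnds ends u) (splitRegion U) (Sum.inl h) ξ := allRed_mem_outClass hcl₁ hc₁
  -- the fibre is the orbit of the split graph intersected with the side `Q` of the split graph
  have hfib : ∀ (P P' : Config E → Prop), (∀ ζ, SplitFine ends u h ζ → (P ζ ↔ P' ζ)) →
      ((swOutSide ends l h o U ξ).filter (fun ζ => P ζ ∧ SplitFine ends u h ζ)).filter
          (fun ζ => can ζ = can ζ₁) =
        (orbit (splitEnds ends u) (allRed (splitEnds ends u) ζ₁ (Sum.inl h)) (Sum.inl h)).filter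
          fun ζ' => ζ' ∈ tgtU (splitEnds ends u) (Sum.inl l) (Sum.inl h)
            {S : Set (V ⊕ E) | Sum.inl o ∈ S} ∧ P' ζ' := by
    intro P P' hPP'
    ext ζ'
    simp only [Finset.mem_filter, orbit, Finset.mem_image, Finset.mem_univ, true_and, can]
    constructor
    · rintro ⟨⟨hζ', hP, hSF⟩, hcan⟩
      have hc' : CoreFree (splitEnds ends u) ζ' (Sum.inl h) :=
        coreFree_split_of_splitFine hloop_u hhu hout hζ' hSF
      obtain ⟨ω, hω⟩ := exists_orbitReal_eq hc' hcan
      exact ⟨⟨ω, hω⟩, mem_tgtU_split_of_mem hSF hlu (mem_swOutSide.1 hζ').1, (hPP' ζ' hSF).1 hP⟩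
    · rintro ⟨⟨ω, rfl⟩, hQ', hP'⟩
      have hSF' : SplitFine ends u h
          (orbitReal (splitEnds ends u) (allRed (splitEnds ends u) ζ₁ (Sum.inl h)) (Sum.inl h) ω) := by
        intro e he
        rw [hull_orbitReal hc₀, hull_allRed hc₁]
        exact hSF₁ e he
      have hcl' := orbitReal_mem_outClass hc₀ hcl₀ ω
      refine ⟨⟨mem_swOutSide.2 ⟨mem_tgtU_of_mem_split hloop_u hlu hSF' hQ',
        mem_outClass_of_mem_split hu hloop_u hhu hSF' hcl'⟩, (hPP' _ hSF').2 hP', hSF'⟩, ?_⟩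
      rw [allRed_orbitReal hc₀ ω, allRed_idem hc₁]
  rw [hfib _ (fun ζ' => redEdges (splitEnds ends u) ζ' (Sum.inl h) ∈ 𝓔)
      (fun ζ hSF => by rw [redEdges_eq_of_splitFine hloop_u hhu hSF]),
    hfib _ (fun ζ' => blueEdges (splitEnds ends u) ζ' (Sum.inl h) ∈ 𝓔)
      (fun ζ hSF => by rw [blueEdges_eq_of_splitFine hloop_u hhu hSF])]
  exact card_orbit_le hc₀ hloop' hcl₀ hl' h𝓔

include hloop_h hloop_u hhu hadj hout hl in
/-- **The non-split-fine part**: orbit by orbit of the graph's own arm principle. -/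
theorem card_not_splitFine_le {𝓔 : Set (Set E)} (h𝓔 : IsUpperSet 𝓔) :
    ((swOutSide ends l h o U ξ).filter fun ζ =>
        redEdges ends ζ h ∈ 𝓔 ∧ ¬ SplitFine ends u h ζ).card ≤
      ((swOutSide ends l h o U ξ).filter fun ζ =>
        blueEdges ends ζ h ∈ 𝓔 ∧ ¬ SplitFine ends u h ζ).card := by
  let can : Config E → Config E := fun ζ => allRed ends ζ h
  let F : Finset (Config E) := (swOutSide ends l h o U ξ).filter fun ζ => ¬ SplitFine ends u h ζ
  let S₀ : Finset (Config E) := F.image can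
  have hmap : ∀ (P : Config E → Prop) (ζ : Config E),
      ζ ∈ (swOutSide ends l h o U ξ).filter (fun ζ => P ζ ∧ ¬ SplitFine ends u h ζ) →
        can ζ ∈ S₀ := by
    intro P ζ hζ
    have hζ' := Finset.mem_filter.1 hζ
    exact Finset.mem_image_of_mem can (Finset.mem_filter.2 ⟨hζ'.1, hζ'.2.2⟩)
  rw [Finset.card_eq_sum_card_fiberwise (hmap _), Finset.card_eq_sum_card_fiberwise (hmap _)]
  refine Finset.sum_le_sum fun ζ₀ hζ₀ => ?_
  obtain ⟨ζ₁, hζ₁, rfl⟩ := Finset.mem_image.1 hζ₀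
  have hζ₁' := Finset.mem_filter.1 hζ₁
  have hnf₁ : ¬ SplitFine ends u h ζ₁ := hζ₁'.2
  have hc₁ : CoreFree ends ζ₁ h := coreFree_of_not_splitFine hloop_u hhu hadj hout hζ₁'.1 hnf₁
  have hcl₁ : ζ₁ ∈ outClass ends U h ξ := (mem_swOutSide.1 hζ₁'.1).2
  have hc₀ : CoreFree ends (allRed ends ζ₁ h) h := coreFree_allRed hc₁
  have hcl₀ : allRed ends ζ₁ h ∈ outClass ends U h ξ := allRed_mem_outClass hcl₁ hc₁
  have hnf₀ : ¬ SplitFine ends u h (allRed ends ζ₁ h) :=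
    not_splitFine_flip hloop_u hhu hadj hc₁ (armClosed_blueSide hc₁) hnf₁
  have hfib : ∀ (P : Config E → Prop),
      ((swOutSide ends l h o U ξ).filter (fun ζ => P ζ ∧ ¬ SplitFine ends u h ζ)).filter
          (fun ζ => can ζ = can ζ₁) =
        (orbit ends (allRed ends ζ₁ h) h).filter
          fun ζ' => ζ' ∈ tgtU ends l h {S : Set V | o ∈ S} ∧ P ζ' := by
    intro P
    ext ζ'
    simp only [Finset.mem_filter, orbit, Finset.mem_image, Finset.mem_univ, true_and, can]
    constructor
    · rintro ⟨⟨hζ', hP, hnf⟩, hcan⟩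
      have hc' : CoreFree ends ζ' h := coreFree_of_not_splitFine hloop_u hhu hadj hout hζ' hnf
      obtain ⟨ω, hω⟩ := exists_orbitReal_eq hc' hcan
      exact ⟨⟨ω, hω⟩, (mem_swOutSide.1 hζ').1, hP⟩
    · rintro ⟨⟨ω, rfl⟩, hQ, hP⟩
      have hnf' : ¬ SplitFine ends u h (orbitReal ends (allRed ends ζ₁ h) h ω) := by
        show ¬ SplitFine ends u h
          (flip ends (armsFalse ends (allRed ends ζ₁ h) h ω) (allRed ends (allRed ends ζ₁ h) h))
        refine not_splitFine_flip hloop_u hhu hadj (coreFree_allRed hc₀)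
          (armClosed_armsFalse_allRed hc₀ ω) ?_
        exact not_splitFine_flip hloop_u hhu hadj hc₀ (armClosed_blueSide hc₀) hnf₀
      refine ⟨⟨mem_swOutSide.2 ⟨hQ, orbitReal_mem_outClass hc₀ hcl₀ ω⟩, hP, hnf'⟩, ?_⟩
      rw [allRed_orbitReal hc₀ ω, allRed_idem hc₁]
  rw [hfib, hfib]
  exact card_orbit_le hc₀ hloop_h hcl₀ hl h𝓔

include hl hloop_h hloop_u hu hhu hadj hout in
/-- **THE JUNCTION THEOREM**: the rigid counting inequality of (HLC) on every class of a region with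
one junction `u` (no loop at `h` or `u`, `u` without outside edge, every neighbour `p ≠ h` of `u`
adjacent to `h`, every other vertex of `U ∖ {h, o}` with an outside edge or no edge). -/
theorem rigidOK_of_junction {𝓔 : Set (Set E)} (h𝓔 : IsUpperSet 𝓔) :
    ((swOutSide ends l h o U ξ).filter fun ζ => redEdges ends ζ h ∈ 𝓔).card ≤
      ((swOutSide ends l h o U ξ).filter fun ζ => blueEdges ends ζ h ∈ 𝓔).card := by
  have hsplit : ∀ P : Config E → Prop,
      ((swOutSide ends l h o U ξ).filter P).card =
        ((swOutSide ends l h o U ξ).filter fun ζ => P ζ ∧ SplitFine ends u h ζ).card +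
        ((swOutSide ends l h o U ξ).filter fun ζ => P ζ ∧ ¬ SplitFine ends u h ζ).card := by
    intro P
    rw [← Finset.filter_filter, ← Finset.filter_filter,
      Finset.card_filter_add_card_filter_not]
  rw [hsplit, hsplit]
  exact Nat.add_le_add (card_splitFine_le hl hloop_h hloop_u hu hhu hout h𝓔)
    (card_not_splitFine_le hl hloop_h hloop_u hhu hadj hout h𝓔)

end Main

end LocRows

end Summit.Ventures.PercRepro2
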